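import Summits.AnomalousDissipation.AnomalousDissipation.Theorems.MarginalStabilityChainStrainedLayerLawClockLine
import Summits.AnomalousDissipation.AnomalousDissipation.Theorems.MarginalStabilityChainStrainedLayerLawStubVorticityUniformBoundsD
import Summits.AnomalousDissipation.AnomalousDissipation.Theorems.MarginalStabilityChainStrainedLayerLawStubVorticityUniformBoundsF
import Mathlib.Analysis.Calculus.ParametricIntegral

/-!
# Stub `stub_negEnstrophyLaw` of line `FirstLemmasR2K4` (log-enstrophy clock; crux `MarginalStabilityChain.StrainedLayerLaw`,
# stmt-AnomalousDissipation-3007) — tools C: space–time continuity of `∇ω`, continuity and differentiation in time of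
# cut-off strip functionals

Support file (`--supports stmt-AnomalousDissipation-3007`; registered sub-goal `stub_negEnstrophyLaw_timeDerivative`).
For velocity fields `u, v` jointly `C²` on `(0, ∞) × ℝ²` (`ω(t) = ∂ₓv(t) − ∂_yu(t)`):
* the slice gradient `(∂ₓω, ∂_yω)` of the vorticity is a pair of second space derivatives, hence jointly continuous on
  `(0, ∞) × ℝ²` (`clock_continuousOn_dX/dY_vorticity_spacetime`, via the space–time calculus of tools F of p120637);
* a strip functional `t ↦ ∫∫_{(0,L]×ℝ} H(t, x, y)` of a jointly continuous integrand vanishing for `|y| ≥ R′` is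
  continuous on `(0, ∞)` (`clock_continuousOn_strip_integral`, dominated convergence on compact time intervals);
* **differentiation under the integral sign** (`stub_negEnstrophyLaw_timeDerivative`): for `F ∈ C¹(ℝ)` and a bounded
  continuous weight `ψ` vanishing for `|y| ≥ R′`, `d/dt ∫∫ F(ω(t))ψ = ∫∫ F′(ω(t))ψ (∂ₓ∂ₜv − ∂_y∂ₜu)` on `t > 0`
  (the `F`-analogue of `kato_hasDerivAt_enstrophy`, tools L).
All `[folklore]`.
-/

-- `Summit.<Summit>.<Problem>` is the tree's mandated summit-side namespace (CONVENTIONS §2); for this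
-- single-conjunct summit the two coincide, so the duplicate is deliberate.
set_option linter.dupNamespace false

noncomputable section

open scoped Topology ENNReal
open Filter Set Function MeasureTheory

namespace Summit.AnomalousDissipation.AnomalousDissipation.Theorems.StrainedLayerLaw.LogEnstrophyClock

open Literature.Analysis.FluidPDE Literature.Analysis.FluidPDE.StretchedLayer
open Summit.AnomalousDissipation.AnomalousDissipation.Theses.MarginalStabilityChain
open Summit.AnomalousDissipation.AnomalousDissipation.Theorems.StrainedLayerLaw.StrainWorkSumRule

/-! ## The slice gradient of the vorticity in space–time -/

section Gradient

variable {u v : ℝ → ℝ → ℝ → ℝ}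

/-- `x`-lines of the vorticity slice: `∂ₓω(t, x, y) = D²v(e₂, e₂) − D²u(e₃, e₂)` (`t > 0`). [folklore] -/
theorem clock_hasDerivAt_vorticity_x
    (hu : ContDiffOn ℝ 2 (fun q : ℝ × ℝ × ℝ => u q.1 q.2.1 q.2.2) (Ioi 0 ×ˢ univ))
    (hv : ContDiffOn ℝ 2 (fun q : ℝ × ℝ × ℝ => v q.1 q.2.1 q.2.2) (Ioi 0 ×ˢ univ)) {t : ℝ} (ht : 0 < t)
    (x y : ℝ) : HasDerivAt (fun s => vorticity (u t) (v t) s y)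
      (fderiv ℝ (fun r => fderiv ℝ (fun q : ℝ × ℝ × ℝ => v q.1 q.2.1 q.2.2) r (0, 1, 0)) (t, x, y) (0, 1, 0) -
        fderiv ℝ (fun r => fderiv ℝ (fun q : ℝ × ℝ × ℝ => u q.1 q.2.1 q.2.2) r (0, 0, 1)) (t, x, y) (0, 1, 0)) x := by
  have h1 := kato_hasDerivAt_x_fderiv2 hv (0, 1, 0) ht x y
  have h2 := kato_hasDerivAt_x_fderiv2 hu (0, 0, 1) ht x y
  have e1 : (fun s => fderiv ℝ (fun q : ℝ × ℝ × ℝ => v q.1 q.2.1 q.2.2) (t, s, y) (0, 1, 0)) = fun s => dX (v t) s y :=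
    funext fun s => ((kato_hasDerivAt_x_fderiv hv ht s y).deriv).symm
  have e2 : (fun s => fderiv ℝ (fun q : ℝ × ℝ × ℝ => u q.1 q.2.1 q.2.2) (t, s, y) (0, 0, 1)) = fun s => dY (u t) s y :=
    funext fun s => ((kato_hasDerivAt_y_fderiv hu ht s y).deriv).symm
  rw [e1] at h1
  rw [e2] at h2
  exact h1.sub h2

/-- `y`-lines of the vorticity slice: `∂_yω(t, x, y) = D²v(e₂, e₃) − D²u(e₃, e₃)` (`t > 0`). [folklore] -/
theorem clock_hasDerivAt_vorticity_y
    (hu : ContDiffOn ℝ 2 (fun q : ℝ × ℝ × ℝ => u q.1 q.2.1 q.2.2) (Ioi 0 ×ˢ univ))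
    (hv : ContDiffOn ℝ 2 (fun q : ℝ × ℝ × ℝ => v q.1 q.2.1 q.2.2) (Ioi 0 ×ˢ univ)) {t : ℝ} (ht : 0 < t)
    (x y : ℝ) : HasDerivAt (fun s => vorticity (u t) (v t) x s)
      (fderiv ℝ (fun r => fderiv ℝ (fun q : ℝ × ℝ × ℝ => v q.1 q.2.1 q.2.2) r (0, 1, 0)) (t, x, y) (0, 0, 1) -
        fderiv ℝ (fun r => fderiv ℝ (fun q : ℝ × ℝ × ℝ => u q.1 q.2.1 q.2.2) r (0, 0, 1)) (t, x, y) (0, 0, 1)) y := by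
  have h1 := kato_hasDerivAt_y_fderiv2 hv (0, 1, 0) ht x y
  have h2 := kato_hasDerivAt_y_fderiv2 hu (0, 0, 1) ht x y
  have e1 : (fun s => fderiv ℝ (fun q : ℝ × ℝ × ℝ => v q.1 q.2.1 q.2.2) (t, x, s) (0, 1, 0)) = fun s => dX (v t) x s :=
    funext fun s => ((kato_hasDerivAt_x_fderiv hv ht x s).deriv).symm
  have e2 : (fun s => fderiv ℝ (fun q : ℝ × ℝ × ℝ => u q.1 q.2.1 q.2.2) (t, x, s) (0, 0, 1)) = fun s => dY (u t) x s :=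
    funext fun s => ((kato_hasDerivAt_y_fderiv hu ht x s).deriv).symm
  rw [e1] at h1
  rw [e2] at h2
  exact h1.sub h2

/-- Joint continuity on `(0,∞) × ℝ²` of `(t, x, y) ↦ ∂ₓω(t, x, y)`. [folklore] -/
theorem clock_continuousOn_dX_vorticity_spacetime
    (hu : ContDiffOn ℝ 2 (fun q : ℝ × ℝ × ℝ => u q.1 q.2.1 q.2.2) (Ioi 0 ×ˢ univ))
    (hv : ContDiffOn ℝ 2 (fun q : ℝ × ℝ × ℝ => v q.1 q.2.1 q.2.2) (Ioi 0 ×ˢ univ)) :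
    ContinuousOn (fun q : ℝ × ℝ × ℝ => dX (vorticity (u q.1) (v q.1)) q.2.1 q.2.2) (Ioi 0 ×ˢ univ) := by
  refine ((kato_continuousOn_fderiv2 hv (0, 1, 0) (0, 1, 0)).sub
    (kato_continuousOn_fderiv2 hu (0, 0, 1) (0, 1, 0))).congr ?_
  rintro ⟨t, x, y⟩ ⟨ht, -⟩
  exact (clock_hasDerivAt_vorticity_x hu hv ht x y).deriv

/-- Joint continuity on `(0,∞) × ℝ²` of `(t, x, y) ↦ ∂_yω(t, x, y)`. [folklore] -/
theorem clock_continuousOn_dY_vorticity_spacetime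
    (hu : ContDiffOn ℝ 2 (fun q : ℝ × ℝ × ℝ => u q.1 q.2.1 q.2.2) (Ioi 0 ×ˢ univ))
    (hv : ContDiffOn ℝ 2 (fun q : ℝ × ℝ × ℝ => v q.1 q.2.1 q.2.2) (Ioi 0 ×ˢ univ)) :
    ContinuousOn (fun q : ℝ × ℝ × ℝ => dY (vorticity (u q.1) (v q.1)) q.2.1 q.2.2) (Ioi 0 ×ˢ univ) := by
  refine ((kato_continuousOn_fderiv2 hv (0, 1, 0) (0, 0, 1)).sub
    (kato_continuousOn_fderiv2 hu (0, 0, 1) (0, 0, 1))).congr ?_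
  rintro ⟨t, x, y⟩ ⟨ht, -⟩
  exact (clock_hasDerivAt_vorticity_y hu hv ht x y).deriv

/-- Joint continuity on `(0,∞) × ℝ²` of the velocity component `(t, x, y) ↦ w(t, x, y)` itself. [folklore] -/
theorem clock_continuousOn_spacetime {w : ℝ → ℝ → ℝ → ℝ}
    (hw : ContDiffOn ℝ 2 (fun q : ℝ × ℝ × ℝ => w q.1 q.2.1 q.2.2) (Ioi 0 ×ˢ univ)) :
    ContinuousOn (fun q : ℝ × ℝ × ℝ => w q.1 q.2.1 q.2.2) (Ioi 0 ×ˢ univ) :=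
  hw.continuousOn

/-- Time lines through a point of the open space–time domain of a jointly continuous field are continuous
(`t > 0`). [folklore] -/
theorem clock_continuousAt_time {W : ℝ × ℝ × ℝ → ℝ} (hW : ContinuousOn W (Ioi 0 ×ˢ univ)) {t : ℝ} (ht : 0 < t)
    (q : ℝ × ℝ) : ContinuousAt (fun s => W (s, q)) t := by
  have h1 : ContinuousAt W (t, q) := hW.continuousAt (kato_isOpen_spacetime.mem_nhds ⟨ht, mem_univ _⟩)
  have h2 : ContinuousAt (fun s : ℝ => ((s, q) : ℝ × ℝ × ℝ)) t := (continuous_id.prodMk continuous_const).continuousAt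
  exact ContinuousAt.comp (g := W) (f := fun s : ℝ => ((s, q) : ℝ × ℝ × ℝ)) h1 h2

end Gradient

/-! ## Continuity in time of cut-off strip functionals -/

section StripContinuity

/-- **Continuity of cut-off strip functionals.** If `H` is continuous on `(0,∞) × ℝ²` and vanishes for `|y| ≥ R′`,
then `t ↦ ∫∫_{(0,L]×ℝ} H(t, x, y)` is continuous on `(0, ∞)` (on `[t₀/2, t₀ + 1] × [0, L] × [−R′, R′]` the integrand is
bounded, so dominated convergence applies). [folklore] -/
theorem clock_continuousOn_strip_integral {H : ℝ × ℝ × ℝ → ℝ} (hH : ContinuousOn H (Ioi 0 ×ˢ univ)) {R' : ℝ}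
    (h0 : ∀ t x y, 0 < t → R' ≤ |y| → H (t, x, y) = 0) (L : ℝ) :
    ContinuousOn (fun t => ∫ q in Ioc 0 L ×ˢ univ, H (t, q)) (Ioi 0) := by
  intro t₀ ht₀
  have ht₀' : 0 < t₀ := ht₀
  refine ContinuousAt.continuousWithinAt ?_
  have hlo : 0 < t₀ / 2 := by positivity
  have hI : t₀ ∈ Ioo (t₀ / 2) (t₀ + 1) := ⟨by linarith, by linarith⟩
  have hSm : MeasurableSet (Ioc (0:ℝ) L ×ˢ (univ : Set ℝ)) := measurableSet_Ioc.prod MeasurableSet.univ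
  have hK : IsCompact (Icc (t₀ / 2) (t₀ + 1) ×ˢ (Icc (0:ℝ) L ×ˢ Icc (-R') R')) :=
    isCompact_Icc.prod (isCompact_Icc.prod isCompact_Icc)
  have hKO : Icc (t₀ / 2) (t₀ + 1) ×ˢ (Icc (0:ℝ) L ×ˢ Icc (-R') R') ⊆ Ioi (0:ℝ) ×ˢ (univ : Set (ℝ × ℝ)) :=
    fun q hq => ⟨hlo.trans_le hq.1.1, mem_univ _⟩
  obtain ⟨M, hM⟩ := hK.exists_bound_of_continuousOn (hH.mono hKO)
  have hM'0 : 0 ≤ max M 0 := le_max_right _ _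
  have hw1 : ∀ y : ℝ, |y| < R' → 1 ≤ Real.exp R' * Real.exp (-1 * |y|) := fun y hy => by
    rw [← Real.exp_add]; exact Real.one_le_exp (by linarith)
  have cH : ∀ {s : ℝ}, 0 < s → Continuous fun q : ℝ × ℝ => H (s, q) := fun hs =>
    hH.comp_continuous (continuous_const.prodMk continuous_id) fun q => ⟨hs, mem_univ _⟩
  refine continuousAt_of_dominated (μ := volume.restrict (Ioc 0 L ×ˢ univ))
    (bound := fun q => max M 0 * Real.exp R' * Real.exp (-1 * |q.2|)) ?_ ?_ ?_ ?_
  · filter_upwards [Ioo_mem_nhds hI.1 hI.2] with s hs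
    exact (cH (hlo.trans hs.1)).aestronglyMeasurable
  · filter_upwards [Ioo_mem_nhds hI.1 hI.2] with s hs
    refine ae_restrict_of_forall_mem hSm ?_
    rintro ⟨x, y⟩ ⟨hx, -⟩
    rw [Real.norm_eq_abs]
    by_cases hy : R' ≤ |y|
    · rw [h0 s x y (hlo.trans hs.1) hy, abs_zero]; positivity
    · push Not at hy
      have hq : ((s, x, y) : ℝ × ℝ × ℝ) ∈ Icc (t₀ / 2) (t₀ + 1) ×ˢ (Icc (0:ℝ) L ×ˢ Icc (-R') R') :=
        ⟨⟨hs.1.le, hs.2.le⟩, ⟨hx.1.le, hx.2⟩, abs_le.1 hy.le⟩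
      have h1 : |H (s, x, y)| ≤ max M 0 := (Real.norm_eq_abs _ ▸ hM _ hq).trans (le_max_left _ _)
      calc |H (s, x, y)| ≤ max M 0 * 1 := by rw [mul_one]; exact h1
        _ ≤ max M 0 * (Real.exp R' * Real.exp (-1 * |y|)) := mul_le_mul_of_nonneg_left (hw1 y hy) hM'0
        _ = max M 0 * Real.exp R' * Real.exp (-1 * |y|) := by ring
  · show IntegrableOn (fun q : ℝ × ℝ => max M 0 * Real.exp R' * Real.exp (-1 * |q.2|)) (Ioc 0 L ×ˢ univ)
    refine integrableOn_strip_of_abs_le_exp (C := max M 0 * Real.exp R') (k := 1) (by fun_prop) (by positivity)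
      one_pos fun x _ y => ?_
    rw [abs_of_nonneg (by positivity)]
  · exact Eventually.of_forall fun q => clock_continuousAt_time hH ht₀' q

end StripContinuity

/-! ## Differentiation in time under the integral sign -/

section TimeDerivative

/-- **Differentiation under the integral sign (registered sub-goal `stub_negEnstrophyLaw_timeDerivative`).** For `u, v`
jointly `C²` on `(0,∞) × ℝ²`, `F ∈ C¹(ℝ)` (`F′` continuous), a continuous weight `ψ` with `|ψ| ≤ 1` vanishing for
`|y| ≥ R′`, and `0 < lo < t < hi`: `d/dt ∫∫_{(0,L]×ℝ} F(ω(t))ψ = ∫∫ F′(ω(t))ψ (∂ₓ∂ₜv − ∂_y∂ₜu)` (`ω`, `∂ₜω` are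
continuous on `(0,∞) × ℝ²`, hence bounded on `[lo, hi] × [0, L] × [−R′, R′]`, and `F′` is bounded on the range of `ω`
there). [folklore] -/
theorem stub_negEnstrophyLaw_timeDerivative : ∀ (u v : ℝ → ℝ → ℝ → ℝ) (F F' ψ : ℝ → ℝ) (L R' lo hi t : ℝ),
    ContDiffOn ℝ 2 (fun q : ℝ × ℝ × ℝ => u q.1 q.2.1 q.2.2) (Ioi 0 ×ˢ univ) →
    ContDiffOn ℝ 2 (fun q : ℝ × ℝ × ℝ => v q.1 q.2.1 q.2.2) (Ioi 0 ×ˢ univ) →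
    (∀ s, HasDerivAt F (F' s) s) → Continuous F' →
    Continuous ψ → (∀ y, |ψ y| ≤ 1) → (∀ y, R' ≤ |y| → ψ y = 0) →
    0 < lo → t ∈ Ioo lo hi →
      HasDerivAt (fun s => ∫ q in Ioc 0 L ×ˢ univ, F (vorticity (u s) (v s) q.1 q.2) * ψ q.2)
        (∫ q in Ioc 0 L ×ˢ univ, F' (vorticity (u t) (v t) q.1 q.2) * ψ q.2 *
          (dX (fun x y => deriv (fun s => v s x y) t) q.1 q.2 - dY (fun x y => deriv (fun s => u s x y) t) q.1 q.2))
        t := by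
  intro u v F F' ψ L R' lo hi t hu hv hF hF'c hψc hψ1 hψ0 hlo ht
  have ht0 : 0 < t := hlo.trans ht.1
  have hpos : ∀ {s : ℝ}, s ∈ Ioo lo hi → 0 < s := fun hs => hlo.trans hs.1
  have hSm : MeasurableSet (Ioc (0:ℝ) L ×ˢ (univ : Set ℝ)) := measurableSet_Ioc.prod MeasurableSet.univ
  have cF : Continuous F := continuous_iff_continuousAt.2 fun s => (hF s).continuousAt
  set Ψ : ℝ × ℝ × ℝ → ℝ := fun q => dX (fun x y => deriv (fun s => v s x y) q.1) q.2.1 q.2.2 -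
    dY (fun x y => deriv (fun s => u s x y) q.1) q.2.1 q.2.2 with hΨ
  set W : ℝ × ℝ × ℝ → ℝ := fun q => vorticity (u q.1) (v q.1) q.2.1 q.2.2 with hW
  have hΨc : ContinuousOn Ψ (Ioi 0 ×ˢ univ) := kato_continuousOn_vorticity_time hu hv
  have hWc : ContinuousOn W (Ioi 0 ×ˢ univ) := kato_continuousOn_vorticity_spacetime hu hv
  have hK : IsCompact (Icc lo hi ×ˢ (Icc (0:ℝ) L ×ˢ Icc (-R') R')) :=
    isCompact_Icc.prod (isCompact_Icc.prod isCompact_Icc)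
  have hKO : Icc lo hi ×ˢ (Icc (0:ℝ) L ×ˢ Icc (-R') R') ⊆ Ioi (0:ℝ) ×ˢ (univ : Set (ℝ × ℝ)) :=
    fun q hq => ⟨hlo.trans_le hq.1.1, mem_univ _⟩
  obtain ⟨M, hM⟩ := hK.exists_bound_of_continuousOn (hΨc.mono hKO)
  obtain ⟨N, hN⟩ := hK.exists_bound_of_continuousOn (hWc.mono hKO)
  obtain ⟨MF, hMF⟩ := (isCompact_Icc : IsCompact (Icc (-max N 0) (max N 0))).exists_bound_of_continuousOn
    hF'c.continuousOn
  have hM'0 : 0 ≤ max M 0 := le_max_right _ _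
  have hN'0 : 0 ≤ max N 0 := le_max_right _ _
  have hMF'0 : 0 ≤ max MF 0 := le_max_right _ _
  have cω : ∀ {s : ℝ}, 0 < s → Continuous fun q : ℝ × ℝ => vorticity (u s) (v s) q.1 q.2 := fun hs =>
    (contDiff_one_vorticity (contDiff_slice hu (mem_Ioi.2 hs)) (contDiff_slice hv (mem_Ioi.2 hs))).continuous
  have cΨt : Continuous fun q : ℝ × ℝ => Ψ (t, q) :=
    hΨc.comp_continuous (continuous_const.prodMk continuous_id) fun q => ⟨ht0, mem_univ _⟩
  have hw1 : ∀ y : ℝ, |y| < R' → 1 ≤ Real.exp R' * Real.exp (-1 * |y|) := fun y hy => by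
    rw [← Real.exp_add]; exact Real.one_le_exp (by linarith)
  have key := hasDerivAt_integral_of_dominated_loc_of_deriv_le (μ := volume.restrict (Ioc 0 L ×ˢ univ))
    (F := fun s q => F (vorticity (u s) (v s) q.1 q.2) * ψ q.2)
    (F' := fun s q => F' (vorticity (u s) (v s) q.1 q.2) * ψ q.2 * Ψ (s, q))
    (bound := fun q => max MF 0 * max M 0 * Real.exp R' * Real.exp (-1 * |q.2|)) (Ioo_mem_nhds ht.1 ht.2)
    ?_ ?_ ?_ ?_ ?_ ?_
  · exact key.2
  · filter_upwards [Ioo_mem_nhds ht.1 ht.2] with s hs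
    exact ((cF.comp (cω (hpos hs))).mul (hψc.comp continuous_snd)).aestronglyMeasurable
  · exact kato_integrableOn_strip_of_eq_zero (R := R') ((cF.comp (cω ht0)).mul (hψc.comp continuous_snd))
      fun x _ y hy => by simp only [hψ0 y hy, mul_zero]
  · exact (((hF'c.comp (cω ht0)).mul (hψc.comp continuous_snd)).mul cΨt).aestronglyMeasurable
  · refine ae_restrict_of_forall_mem hSm ?_
    rintro ⟨x, y⟩ ⟨hx, -⟩ s hs
    rw [Real.norm_eq_abs]
    by_cases hy : R' ≤ |y|
    · simp only [hψ0 y hy, mul_zero, zero_mul, abs_zero]; positivity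
    · push Not at hy
      have hq : ((s, x, y) : ℝ × ℝ × ℝ) ∈ Icc lo hi ×ˢ (Icc (0:ℝ) L ×ˢ Icc (-R') R') :=
        ⟨⟨hs.1.le, hs.2.le⟩, ⟨hx.1.le, hx.2⟩, abs_le.1 hy.le⟩
      have h1 : |Ψ (s, x, y)| ≤ max M 0 := (Real.norm_eq_abs _ ▸ hM _ hq).trans (le_max_left _ _)
      have h2 : |vorticity (u s) (v s) x y| ≤ max N 0 := (Real.norm_eq_abs _ ▸ hN _ hq).trans (le_max_left _ _)
      have h2' : vorticity (u s) (v s) x y ∈ Icc (-max N 0) (max N 0) := abs_le.1 h2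
      have h3 : |F' (vorticity (u s) (v s) x y)| ≤ max MF 0 :=
        (Real.norm_eq_abs _ ▸ hMF _ h2').trans (le_max_left _ _)
      have h4 := hψ1 y
      rw [abs_mul, abs_mul]
      calc |F' (vorticity (u s) (v s) x y)| * |ψ y| * |Ψ (s, x, y)| ≤ max MF 0 * 1 * max M 0 :=
            mul_le_mul (mul_le_mul h3 h4 (abs_nonneg _) hMF'0) h1 (abs_nonneg _) (by positivity)
        _ = max MF 0 * max M 0 * 1 := by ring
        _ ≤ max MF 0 * max M 0 * (Real.exp R' * Real.exp (-1 * |y|)) :=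
            mul_le_mul_of_nonneg_left (hw1 y hy) (by positivity)
        _ = max MF 0 * max M 0 * Real.exp R' * Real.exp (-1 * |y|) := by ring
  · show IntegrableOn (fun q : ℝ × ℝ => max MF 0 * max M 0 * Real.exp R' * Real.exp (-1 * |q.2|)) (Ioc 0 L ×ˢ univ)
    refine integrableOn_strip_of_abs_le_exp (C := max MF 0 * max M 0 * Real.exp R') (k := 1) (by fun_prop)
      (by positivity) one_pos fun x _ y => ?_
    rw [abs_of_nonneg (by positivity)]
  · refine ae_restrict_of_forall_mem hSm ?_
    rintro ⟨x, y⟩ - s hs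
    have hω := stub_vorticityUniformBounds_vorticityTime hu hv (hpos hs) x y
    have h := (HasDerivAt.comp (h₂ := F) (h := fun s => vorticity (u s) (v s) x y) s (hF _) hω).mul_const (ψ y)
    refine h.congr_deriv ?_
    simp only [hΨ]
    ring

end TimeDerivative

end Summit.AnomalousDissipation.AnomalousDissipation.Theorems.StrainedLayerLaw.LogEnstrophyClock

end
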